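import Literature.Geometry.PolyhedralFans.RegularRefinement
import Literature.Geometry.PolyhedralFans.RegularBasis
import HarnessLib

/-!
# Crux `FrobeniusLadder.FRationalResolution` (stmt-ResolutionOfSingularities-15317), line `redirect`,
# stub `stub_diagonalizableQuotientResolution` — the regularisation step through a parallelotope point NEVER TOUCHES A
# REGULAR CONE (first half of the fan brick (α′) of the repair census)

Kempf–Knudsen–Mumford–Saint-Donat / Fulton §2.6: a fan is made regular by star subdivisions through non-zero lattice points of
the half-open fundamental parallelotopes of singular cones. The tree proves the existence of such a step with a dropping
measure (`Fan.exists_step`, `RegularRefinement.lean`) but does not export WHERE the point lies. For the isolated-singularity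
programme (bricks T1 / (ε₁): the subdivision must spare the regular faces of the cone, on whose dual faces the support
function has to vanish) we need: **a non-zero parallelotope point of a cone of a fan lies in no REGULAR cone of the fan**
(the common face is regular, and a regular cone has no parallelotope lattice point but its apex), and the step re-exported
with this guarantee.

* `sum_smul_notMem_of_isRegularGens_of_parCoeffs` — the avoidance lemma;
* `Fan.exists_step_avoiding` — `Fan.exists_step` with the extra conclusion `w ∉ τ` for every regular cone `τ` of the fan;
* **`Fan.exists_regular_starIter_avoiding`** — the regularisation of a primitively simplicial fan by star subdivisions whose
  points avoid, at each step, the regular cones: every REGULAR cone of the original fan is a cone of the regular refinement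
  and contains none of the star points.

Honest label: fan combinatorics toward (α′) (no stub closed); the support function of the composite subdivision vanishing on
the spared cones (ProjectiveSubdivision `starCoord`) is NOT here. No definitions, no named facts, no sorry.
[cite: Fulton1993Toric, §2.6 p. 48] [cite: Ewald1996, VI Thm. 8.5] [cite: KempfEtAl1973, Ch. I §2 Thm. 11]
-/

-- single-problem summit: the doubled namespace component is forced
set_option linter.dupNamespace false

namespace Literature.Geometry.PolyhedralFans

open PointedCone Finset

variable {κ : Type*} [Fintype κ]

/-- **A non-zero parallelotope point of a cone of a fan lies in no regular cone of the fan.** Let `σ, τ` be cones of a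
fan with primitive simplicial generators `S, T`, `T` regular, and `w = Σ a_s s` with `a ∈ parCoeffs S`, `w ≠ 0`. Then
`w ∉ τ`: otherwise `w` lies in the common face `γ = σ ⊓ τ = hull (S ∩ γ) = hull (T ∩ γ)`, its coefficients vanish off `γ`,
so `a` is a parallelotope coefficient vector of the regular family `T ∩ γ`, hence `0`. [cite: Fulton1993Toric, §2.6 p. 48] -/
theorem sum_smul_notMem_of_isRegularGens_of_parCoeffs [DecidableEq κ] {Δ : Fan ℚ (κ → ℚ)}
    {σ τ : PointedCone ℚ (κ → ℚ)} (hσ : σ ∈ Δ.cones) (hτ : τ ∈ Δ.cones) {S T : Finset (κ → ℚ)}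
    (hS : IsPrimGens σ S) (hT : IsPrimGens τ T) (hTreg : IsRegularGens T) {a : (κ → ℚ) → ℚ}
    (ha : a ∈ parCoeffs S) (hw0 : ∑ s ∈ S, a s • s ≠ 0) : ∑ s ∈ S, a s • s ∉ τ := by
  classical
  intro hwτ
  have hwσ : ∑ s ∈ S, a s • s ∈ σ := hS.2.2 ▸ sum_smul_mem_hull (fun s hs => (ha.1 s hs).1)
  -- the common face and its generators
  have hγσ : (σ ⊓ τ).IsFaceOf σ := Δ.inf_isFaceOf hσ hτ
  have hγτ : (σ ⊓ τ).IsFaceOf τ := by rw [inf_comm]; exact Δ.inf_isFaceOf hτ hσ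
  have hγS : σ ⊓ τ = PointedCone.hull ℚ ((S.filter (· ∈ σ ⊓ τ) : Finset _) : Set (κ → ℚ)) :=
    eq_hull_filter_of_isFaceOf_hull (hS.2.2 ▸ hγσ)
  have hγT : σ ⊓ τ = PointedCone.hull ℚ ((T.filter (· ∈ σ ⊓ τ) : Finset _) : Set (κ → ℚ)) :=
    eq_hull_filter_of_isFaceOf_hull (hT.2.2 ▸ hγτ)
  have hfilt : S.filter (· ∈ σ ⊓ τ) = T.filter (· ∈ σ ⊓ τ) :=
    eq_of_hull_eq_hull (fun s hs => hS.1 s (Finset.mem_filter.mp hs).1)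
      (hS.2.1.mono (by intro x hx; exact (Finset.mem_filter.mp (Finset.mem_coe.mp hx)).1))
      (fun s hs => hT.1 s (Finset.mem_filter.mp hs).1)
      (hT.2.1.mono (by intro x hx; exact (Finset.mem_filter.mp (Finset.mem_coe.mp hx)).1))
      (hγS.symm.trans hγT)
  -- the coefficients of `w` vanish off the face
  have hwγ : ∑ s ∈ S, a s • s ∈ σ ⊓ τ := ⟨hwσ, hwτ⟩
  rw [hγS] at hwγ
  obtain ⟨c, -, hcw⟩ := mem_hull_finset_iff.mp hwγ
  let c' : (κ → ℚ) → ℚ := fun s => if s ∈ σ ⊓ τ then c s else 0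
  have hc'sum : ∑ s ∈ S, c' s • s = ∑ s ∈ S, a s • s := by
    rw [← hcw, Finset.sum_filter]
    refine Finset.sum_congr rfl fun s _ => ?_
    simp only [c']
    split_ifs <;> simp
  have heq : ∀ s ∈ S, a s = c' s := eq_on_of_sum_smul_eq hS.2.1 hc'sum.symm
  have hoff : ∀ s ∈ S, s ∉ σ ⊓ τ → a s = 0 := by
    intro s hs hsγ
    rw [heq s hs]
    simp only [c', if_neg hsγ]
  -- `a` is a parallelotope coefficient vector of the regular family `T ∩ γ`
  let a' : (κ → ℚ) → ℚ := fun s => if s ∈ S.filter (· ∈ σ ⊓ τ) then a s else 0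
  have ha'sum : ∑ s ∈ S.filter (· ∈ σ ⊓ τ), a' s • s = ∑ s ∈ S, a s • s := by
    rw [Finset.sum_filter]
    refine Finset.sum_congr rfl fun s hs => ?_
    by_cases hsγ : s ∈ σ ⊓ τ
    · simp only [a', Finset.mem_filter, hs, hsγ, and_self, if_true]
    · rw [if_neg hsγ, hoff s hs hsγ, zero_smul]
  have ha' : a' ∈ parCoeffs (T.filter (· ∈ σ ⊓ τ)) := by
    rw [← hfilt]
    refine ⟨fun s hs => ?_, fun s hs => if_neg hs, ?_⟩
    · simp only [a', if_pos hs]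
      exact ha.1 s (Finset.mem_filter.mp hs).1
    · rw [ha'sum]; exact ha.2.2
  have hreg' : IsRegularGens (T.filter (· ∈ σ ⊓ τ)) := IsRegularGens.mono hTreg (Finset.filter_subset _ _)
  have hzero := (isRegularGens_iff_parCoeffs hreg'.1 hreg'.2.1).1 hreg' a' ha'
  -- hence `a = 0` on `S`, `w = 0`
  apply hw0
  refine Finset.sum_eq_zero fun s hs => ?_
  by_cases hsγ : s ∈ σ ⊓ τ
  · have hs' : s ∈ S.filter (· ∈ σ ⊓ τ) := Finset.mem_filter.mpr ⟨hs, hsγ⟩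
    have h1 := hzero s (hfilt ▸ hs')
    simp only [a', if_pos hs'] at h1
    rw [h1, zero_smul]
  · rw [hoff s hs hsγ, zero_smul]

namespace Fan

-- adapted from Literature/Geometry/PolyhedralFans/RegularRefinement.lean `Fan.exists_step` (one extra conclusion)
/-- **The regularisation step, with the star point off every regular cone** (`Fan.exists_step` re-exported): a
primitively simplicial fan which is not regular admits a non-zero primitive lattice vector `w` in its support — a
parallelotope point of a cone of maximal count — such that the star subdivision through `w` is again primitively
simplicial, the measure `(maxPMult, numMax)` drops lexicographically, AND `w` lies in no regular cone of the fan
(`sum_smul_notMem_of_isRegularGens_of_parCoeffs`), so regular cones survive the step unchanged.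
[cite: Ewald1996, VI Thm. 8.5] [cite: Fulton1993Toric, §2.6 p. 48] -/
theorem exists_step_avoiding [DecidableEq κ] {Δ : Fan ℚ (κ → ℚ)} (hΔ : Δ.IsPrimSimplicial)
    (hnr : ¬ Δ.IsRegular) :
    ∃ w : κ → ℚ, w ∈ latticeN κ ∧ w ∈ Δ.support ∧ w ≠ 0 ∧
      (Δ.starSubdivision w).IsPrimSimplicial ∧
      ((Δ.starSubdivision w).maxPMult < Δ.maxPMult ∨
        ((Δ.starSubdivision w).maxPMult = Δ.maxPMult ∧ (Δ.starSubdivision w).numMax < Δ.numMax)) ∧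
      ∀ τ ∈ Δ.cones, ∀ T : Finset (κ → ℚ), IsPrimGens τ T → IsRegularGens T → w ∉ τ := by
  classical
  -- a non-regular cone exists, so the maximal count is `≥ 2`
  obtain ⟨ρ, hρ, hρnr⟩ : ∃ ρ ∈ Δ.cones, ∀ S : Finset (κ → ℚ), IsPrimGens ρ S → ¬ IsRegularGens S := by
    by_contra hne
    push Not at hne
    apply hnr
    intro ρ hρ
    obtain ⟨S, hS, hreg⟩ := hne ρ hρ
    exact ⟨S, hreg, hS.2.2⟩
  obtain ⟨Sρ, hSρ⟩ := hΔ.exists_isPrimGens hρ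
  have hM2 : 2 ≤ Δ.maxPMult := by
    have h1 : pmult Sρ ≠ 1 := fun h =>
      hρnr Sρ hSρ (isRegularGens_of_pmult_eq_one hSρ.mem_latticeN hSρ.2.1 h)
    have h2 : 0 < pmult Sρ := pmult_pos hSρ.2.1
    have h3 := conePMult_le_maxPMult hρ
    rw [conePMult_eq hSρ] at h3
    omega
  -- a cone `σ` of maximal count, its generators, a parallelotope point
  have hne : Δ.finite.toFinset.Nonempty := ⟨ρ, Δ.finite.mem_toFinset.mpr hρ⟩
  obtain ⟨σ, hσfin, hσmax⟩ := Finset.exists_mem_eq_sup Δ.finite.toFinset hne conePMult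
  have hσ : σ ∈ Δ.cones := Δ.finite.mem_toFinset.mp hσfin
  obtain ⟨S, hS⟩ := hΔ.exists_isPrimGens hσ
  have hσM : pmult S = Δ.maxPMult := by rw [← conePMult_eq hS, ← hσmax]; rfl
  have hSnr : ¬ IsRegularGens S := fun h => by
    have := pmult_eq_one_of_isRegularGens h; omega
  obtain ⟨a, ha, j, hj, haj⟩ := exists_ne_zero_of_not_isRegularGens hS.mem_latticeN hS.2.1 hSnr
  -- normalise to a primitive point
  set w₀ := ∑ s ∈ S, a s • s with hw₀
  have hw₀N : w₀ ∈ latticeN κ := ha.2.2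
  have hw₀0 : w₀ ≠ 0 := by
    intro h0
    have hzero : ∑ s ∈ S, a s • s = ∑ s ∈ S, (0 : (κ → ℚ) → ℚ) s • s := by
      rw [← hw₀, h0]; simp
    exact haj (eq_on_of_sum_smul_eq hS.2.1 hzero j hj)
  obtain ⟨c, hc0, hc1, hprim⟩ := exists_isPrimitive_smul hw₀N hw₀0
  let a' : (κ → ℚ) → ℚ := fun s => c * a s
  have hw : ∑ s ∈ S, a' s • s = c • w₀ := by
    rw [hw₀, Finset.smul_sum]
    exact Finset.sum_congr rfl fun s _ => by rw [smul_smul]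
  have ha' : a' ∈ parCoeffs S := by
    refine ⟨fun s hs => ⟨mul_nonneg hc0.le (ha.1 s hs).1, ?_⟩, fun s hs => ?_, ?_⟩
    · calc c * a s ≤ 1 * a s := mul_le_mul_of_nonneg_right hc1 (ha.1 s hs).1
        _ < 1 := by rw [one_mul]; exact (ha.1 s hs).2
    · simp only [a', ha.2.1 s hs, mul_zero]
    · rw [hw]; exact hprim.1
  have haj' : a' j ≠ 0 := mul_ne_zero hc0.ne' haj
  set w := ∑ s ∈ S, a' s • s with hwdef
  have hwprim : IsPrimitive w := hw ▸ hprim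
  have hwσ : w ∈ σ := hS.2.2 ▸ sum_smul_mem_hull (fun s hs => (ha'.1 s hs).1)
  have hwsupp : w ∈ Δ.support := mem_support.mpr ⟨σ, hσ, hwσ⟩
  refine ⟨w, hwprim.1, hwsupp, hwprim.2.1, ?_, ?_,
    fun τ hτ T hT hTreg => sum_smul_notMem_of_isRegularGens_of_parCoeffs hσ hτ hS hT hTreg ha' hwprim.2.1⟩
  · -- the star subdivision is primitively simplicial
    intro ρ' hρ'
    rw [starSubdivision_cones] at hρ'
    rcases mem_starCones_iff.mp hρ' with ⟨hρ'Δ, -⟩ | ⟨τ, hτ, hwτ, ⟨σ'', hσ'', hτσ'', hwσ''⟩, rfl⟩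
    · exact hΔ hρ'Δ
    · obtain ⟨T, hTU, hliT, hτT⟩ := hΔ hτ
      refine ⟨insert w T, ?_, ?_, ?_⟩
      · rw [Finset.coe_insert]; exact Set.insert_subset hwprim hTU
      · rw [Finset.coe_insert]
        refine hliT.id_insert fun hwspan => hwτ ?_
        have hface : τ.IsFaceOf σ'' := isFaceOf_of_le hσ'' hτ hτσ''
        refine mem_of_isFaceOf_of_mem_span hface hwσ'' ?_
        rwa [hτT, span_coe_hull]
      · rw [Finset.coe_insert, hull_insert, ← hτT]
  · -- the measure drops
    set Δ' := Δ.starSubdivision w with hΔ'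
    -- every cone of `Δ'` has count `≤ max`, the new ones `< max`
    have hbound : ∀ ρ' ∈ Δ'.cones, conePMult ρ' ≤ Δ.maxPMult ∧
        (conePMult ρ' = Δ.maxPMult → ρ' ∈ Δ.cones ∧ w ∉ ρ') := by
      intro ρ' hρ'
      rw [hΔ', starSubdivision_cones] at hρ'
      rcases mem_starCones_iff.mp hρ' with ⟨hρ'Δ, hwρ'⟩ | ⟨τ, hτ, hwτ, ⟨σ'', hσ'', hτσ'', hwσ''⟩, rfl⟩
      · exact ⟨conePMult_le_maxPMult hρ'Δ, fun _ => ⟨hρ'Δ, hwρ'⟩⟩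
      · obtain ⟨S'', hS''⟩ := hΔ.exists_isPrimGens hσ''
        obtain ⟨T, hT⟩ := hΔ.exists_isPrimGens hτ
        have hnew : IsPrimGens (τ ⊔ ray ℚ w) (insert w T) := by
          refine ⟨?_, ?_, ?_⟩
          · intro s hs
            rcases Finset.mem_insert.mp hs with rfl | hs
            · exact hwprim
            · exact hT.1 s hs
          · rw [Finset.coe_insert]
            refine hT.2.1.id_insert fun hwspan => hwτ ?_
            have hface : τ.IsFaceOf σ'' := isFaceOf_of_le hσ'' hτ hτσ''
            refine mem_of_isFaceOf_of_mem_span hface hwσ'' ?_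
            rwa [hT.2.2, span_coe_hull]
          · rw [Finset.coe_insert, hull_insert, ← hT.2.2]
        have hlt : conePMult (τ ⊔ ray ℚ w) < Δ.maxPMult := by
          rw [conePMult_eq hnew]
          calc pmult (insert w T) < pmult S'' :=
                pmult_insert_lt_of_mem hσ hσ'' hτ hτσ'' hS hS'' hT ha' hwσ'' hwτ
            _ = conePMult σ'' := (conePMult_eq hS'').symm
            _ ≤ Δ.maxPMult := conePMult_le_maxPMult hσ''
        exact ⟨hlt.le, fun h => absurd h hlt.ne⟩
    have hM'le : Δ'.maxPMult ≤ Δ.maxPMult :=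
      Finset.sup_le fun ρ' hρ' => (hbound ρ' (Δ'.finite.mem_toFinset.mp hρ')).1
    rcases hM'le.lt_or_eq with hlt | heq
    · exact Or.inl hlt
    · refine Or.inr ⟨heq, ?_⟩
      -- cones of `Δ'` of maximal count are old maximal cones other than `σ`
      rw [numMax, numMax, heq]
      apply Finset.card_lt_card
      refine ⟨fun ρ' hρ' => ?_, fun hsub => ?_⟩
      · obtain ⟨hρ'fin, hρ'M⟩ := Finset.mem_filter.mp hρ'
        obtain ⟨hρ'Δ, -⟩ := (hbound ρ' (Δ'.finite.mem_toFinset.mp hρ'fin)).2 hρ'M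
        exact Finset.mem_filter.mpr ⟨Δ.finite.mem_toFinset.mpr hρ'Δ, hρ'M⟩
      · have hσin : σ ∈ Δ.finite.toFinset.filter fun ρ => conePMult ρ = Δ.maxPMult :=
          Finset.mem_filter.mpr ⟨hσfin, by rw [conePMult_eq hS, hσM]⟩
        obtain ⟨hσfin', hσM'⟩ := Finset.mem_filter.mp (hsub hσin)
        obtain ⟨-, hwσ'⟩ := (hbound σ (Δ'.finite.mem_toFinset.mp hσfin')).2 hσM'
        exact hwσ' hwσ

/-- **Regularisation sparing the regular cones** (`Fan.exists_regular_starIter_of_isPrimSimplicial` re-run with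
`exists_step_avoiding`): a primitively simplicial fan is refined to a regular fan by finitely many star subdivisions through
non-zero lattice vectors, NONE of which lies in a regular cone of the fan current at that step; consequently **every regular
cone of the original fan is still a cone of the refinement** and contains none of the star points. Induction on
`(maxPMult, numMax)`. [cite: Ewald1996, VI Thm. 8.5] [cite: Fulton1993Toric, §2.6 p. 48] -/
theorem exists_regular_starIter_avoiding [DecidableEq κ] {Δ : Fan ℚ (κ → ℚ)} (hΔ : Δ.IsPrimSimplicial) :
    ∃ l : List (κ → ℚ), (∀ w ∈ l, w ∈ latticeN κ ∧ w ≠ 0) ∧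
      (Δ.starIter l).Refines Δ ∧ (Δ.starIter l).IsRegular ∧
      ∀ τ ∈ Δ.cones, ∀ T : Finset (κ → ℚ), IsPrimGens τ T → IsRegularGens T →
        τ ∈ (Δ.starIter l).cones ∧ ∀ w ∈ l, w ∉ τ := by
  suffices h : ∀ M N : ℕ, ∀ Δ : Fan ℚ (κ → ℚ), Δ.IsPrimSimplicial → Δ.maxPMult = M →
      Δ.numMax = N → ∃ l : List (κ → ℚ), (∀ w ∈ l, w ∈ latticeN κ ∧ w ≠ 0) ∧
        (Δ.starIter l).Refines Δ ∧ (Δ.starIter l).IsRegular ∧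
        ∀ τ ∈ Δ.cones, ∀ T : Finset (κ → ℚ), IsPrimGens τ T → IsRegularGens T →
          τ ∈ (Δ.starIter l).cones ∧ ∀ w ∈ l, w ∉ τ from h _ _ Δ hΔ rfl rfl
  intro M
  induction M using Nat.strong_induction_on with
  | _ M ihM =>
    intro N
    induction N using Nat.strong_induction_on with
    | _ N ihN =>
      intro Δ hΔ hM hN
      by_cases hreg : Δ.IsRegular
      · exact ⟨[], fun _ h => absurd h List.not_mem_nil, Refines.refl Δ, hreg,
          fun τ hτ _ _ _ => ⟨hτ, fun _ h => absurd h List.not_mem_nil⟩⟩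
      · obtain ⟨w, hwN, hwsupp, hw0, hΔ', hlex, havoid⟩ := exists_step_avoiding hΔ hreg
        have hstep : (Δ.starSubdivision w).Refines Δ := (starSubdivision_refines hwsupp hw0).1
        obtain ⟨l, hl, href, hreg', hkeep⟩ : ∃ l : List (κ → ℚ), (∀ w ∈ l, w ∈ latticeN κ ∧ w ≠ 0) ∧
            ((Δ.starSubdivision w).starIter l).Refines (Δ.starSubdivision w) ∧
            ((Δ.starSubdivision w).starIter l).IsRegular ∧
            ∀ τ ∈ (Δ.starSubdivision w).cones, ∀ T : Finset (κ → ℚ), IsPrimGens τ T → IsRegularGens T →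
              τ ∈ ((Δ.starSubdivision w).starIter l).cones ∧ ∀ w ∈ l, w ∉ τ := by
          rcases hlex with h1 | ⟨h1, h2⟩
          · exact ihM _ (hM ▸ h1) _ _ hΔ' rfl rfl
          · exact ihN _ (hN ▸ h2) _ hΔ' (h1.trans hM) rfl
        refine ⟨w :: l, fun v hv => ?_, ?_, ?_, fun τ hτ T hT hTreg => ?_⟩
        · rcases List.mem_cons.mp hv with rfl | hv
          · exact ⟨hwN, hw0⟩
          · exact hl v hv
        · rw [starIter_cons]; exact href.trans hstep
        · rw [starIter_cons]; exact hreg'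
        · -- the regular cone `τ` survives the step (the star point avoids it) and, by induction, the rest
          have hwτ : w ∉ τ := havoid τ hτ T hT hTreg
          have hτ' : τ ∈ (Δ.starSubdivision w).cones := by
            rw [starSubdivision_cones]; exact mem_starCones_of_not_mem hτ hwτ
          obtain ⟨hτl, hlτ⟩ := hkeep τ hτ' T hT hTreg
          refine ⟨by rw [starIter_cons]; exact hτl, fun v hv => ?_⟩
          rcases List.mem_cons.mp hv with rfl | hv
          · exact hwτ
          · exact hlτ v hv

end Fan

end Literature.Geometry.PolyhedralFans
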